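import Literature.NumberTheory.Sieve.FordMaynardFragmentationForward
import Literature.NumberTheory.Sieve.FordMaynardFragmentationBackward
import HarnessLib

/-!
# Ford–Maynard, Theorem 6.4: (TypeI-f) ⇔ fragmentation relation — the discharge

Everything here is PROVED. We assemble the two directions of Theorem 6.4 of K. Ford, J. Maynard,
*On the theory of prime producing sieves* (arXiv:2407.14368) proved in
`FordMaynardFragmentationForward.lean` (`MemTypeIStar.fragRel`: (TypeI-f) ⇒ (6.3), via (Tzero))
and `FordMaynardFragmentationBackward.lean` (`typeI_of_fragRel`: (6.3) ⇒ (TypeI-f), via the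
symmetrisation `claim` and Lemma 5.4), discharging the named fact `FordMaynardFragmentation` of
`Literature/NumberTheory/Sieve/FordMaynardFragmentation.lean`.

## References

* K. Ford, J. Maynard, *On the theory of prime producing sieves*, arXiv:2407.14368 (2024),
  Theorem 6.4 and its proof, §6.1. [FordMaynard2024PrimeSieves]
-/

noncomputable section

namespace Literature.NumberTheory.Sieve.FordMaynard

/-- **Ford–Maynard, Theorem 6.4** (discharge of the named fact `FordMaynardFragmentation`): for
`0 < γ < 1`, `0 < η` and `f ∈ 𝒮` bounded, supported on the vectors with all entries `≥ η`
summing to `1`, piecewise Lipschitz in each dimension, (TypeI-f) with parameter `γ` holds if and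
only if `f` satisfies the fragmentation relation `FragRel γ η f` ((6.3), equivalently (fsl)).
[cite: FordMaynard2024PrimeSieves, Theorem 6.4] -/
theorem FordMaynardFragmentation_holds : FordMaynardFragmentation := by
  intro γ η _hγ hγ1 hη f hs hbdd hsupp hpl
  have hfm : ∀ k, Measurable (f k) := fun k => (hpl k).measurable
  constructor
  · intro hTI
    have hf : MemTypeIStar η γ f :=
      { symm := hs
        support := hsupp
        bounded := hbdd
        piecewiseLipschitz := hpl
        typeI := hTI }
    exact hf.fragRel hη hγ1
  · intro hFR
    obtain ⟨Fb, hFb⟩ := hbdd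
    exact typeI_of_fragRel hη hγ1 hs hfm hFb hsupp hFR

end Literature.NumberTheory.Sieve.FordMaynard
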